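import Summits.ABC.ABC.Theses.TwistAmplification

/-!
# Crux `TwistAmplification.SomeWindowSaving` (stmt-ABC-1976): the window count and a Frey family

Definitions used by the negative-side (cdisprove) files `Negative/*` of this crux:

* `windowSet κ σ X` — the set-builder of the crux verbatim (reduced global minimal models `W₀/ℤ` with
  `c₄ c₆ ≠ 0`, conductor `N ≤ X`, `N^κ ≤ M⁺ := max(|Δ|,|c₄|³) ≤ N^σ`), `windowCount = ncard`, and
  `someWindowSaving_iff` (the crux is `∃ κ σ δ C, 3<κ<σ, δ<(σ−κ)/(2σ−6), ∀ X ≥ 1, T ≤ C X^δ`, rfl);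
* `freyFamily p = ⟨0, −1, 0, −(3k²+k), 2k³+2k²⟩`, `k = kOf p = (4p²−1)/3`: the reduced translate
  `x ↦ x − k` of B–G (12.17) `y² = x(x−1)(x+3k)`, i.e. the Frey curve of `1 + (4p²−1) = 4p²`, with its
  covariants `c₄ = 16(A²+AB+B²)`, `c₆ = −32(B−A)(2A+B)(A+2B)`, `Δ = 16(AB(A+B))²`, `(A,B) = (1,3k)`.
-/

noncomputable section

open WeierstrassCurve

namespace Summit.ABC.ABC.Theorems.SomeWindowSaving.Negative

/-! ## §0 The window count -/

/-- The window slice of the crux, verbatim: reduced global minimal models `W₀` with `c₄ c₆ ≠ 0`,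
conductor `N ≤ X` and `N^κ ≤ M⁺ := max(|Δ|,|c₄|³) ≤ N^σ`. -/
def windowSet (κ σ X : ℝ) : Set (WeierstrassCurve ℤ) :=
  {W₀ : WeierstrassCurve ℤ | (W₀.baseChange ℚ).IsElliptic ∧
    (∀ v : IsDedekindDomain.HeightOneSpectrum ℤ, (W₀.baseChange ℚ).IsMinimalAt v) ∧
    (W₀.a₁ = 0 ∨ W₀.a₁ = 1) ∧ (W₀.a₃ = 0 ∨ W₀.a₃ = 1) ∧ (W₀.a₂ = -1 ∨ W₀.a₂ = 0 ∨ W₀.a₂ = 1) ∧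
    W₀.c₄ ≠ 0 ∧ W₀.c₆ ≠ 0 ∧
    (((W₀.baseChange ℚ).conductorNorm ℤ : ℕ) : ℝ) ≤ X ∧
    (((W₀.baseChange ℚ).conductorNorm ℤ : ℕ) : ℝ) ^ κ ≤ ((max |W₀.Δ| (|W₀.c₄| ^ 3) : ℤ) : ℝ) ∧
    ((max |W₀.Δ| (|W₀.c₄| ^ 3) : ℤ) : ℝ) ≤ (((W₀.baseChange ℚ).conductorNorm ℤ : ℕ) : ℝ) ^ σ}

/-- `T⁺_[κ,σ](X)`, the crux's count. -/
def windowCount (κ σ X : ℝ) : ℕ := (windowSet κ σ X).ncard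

/-- The crux, restated through `windowCount` (definitional). -/
theorem someWindowSaving_iff :
    Summit.ABC.ABC.Theses.TwistAmplification.SomeWindowSaving ↔
      ∃ κ σ δ C : ℝ, 3 < κ ∧ κ < σ ∧ δ < (σ - κ) / (2 * σ - 6) ∧
        ∀ X : ℝ, 1 ≤ X → (windowCount κ σ X : ℝ) ≤ C * X ^ δ :=
  Iff.rfl

/-! ## §2b The family `freyFamily p`: Frey curves of `(1, 4p² − 1, 4p²)` in reduced minimal form -/

section Family

/-- `k(p) = (4p² − 1)/3` (exact when `3 ∤ p`). -/
def kOf (p : ℕ) : ℤ := (4 * (p : ℤ) ^ 2 - 1) / 3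

/-- The reduced global minimal model `y² = x³ − x² − (3k² + k) x + (2k³ + 2k²)`
`= (x − k)(x − k − 1)(x + 2k)`, `k = k(p)`: the translate `x ↦ x − k` of B–G (12.17)
`y² = x (x − 1) (x + 3k)` for `(A, B) = (1, 3k) = (1, 4p² − 1)`, i.e. the Frey curve of the abc
triple `1 + (4p² − 1) = 4p²`.  Reduced: `a₁ = a₃ = 0`, `a₂ = −1`. -/
def freyFamily (p : ℕ) : WeierstrassCurve ℤ :=
  ⟨0, -1, 0, -(3 * kOf p ^ 2 + kOf p), 2 * kOf p ^ 3 + 2 * kOf p ^ 2⟩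

variable {p : ℕ}

/-- `3 ∣ 4p² − 1` when `3 ∤ p`. -/
theorem three_dvd_four_mul_sq_sub_one (hp : ¬ 3 ∣ p) : (3 : ℤ) ∣ 4 * (p : ℤ) ^ 2 - 1 := by
  obtain ⟨t, ht⟩ : ∃ t : ℕ, p = 3 * t + 1 ∨ p = 3 * t + 2 := ⟨p / 3, by omega⟩
  rcases ht with ht | ht
  · refine ⟨12 * t ^ 2 + 8 * t + 1, ?_⟩
    rw [ht]; push_cast; ring
  · refine ⟨12 * t ^ 2 + 16 * t + 5, ?_⟩
    rw [ht]; push_cast; ring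

/-- `3 k(p) = 4p² − 1` when `3 ∤ p`. -/
theorem three_mul_kOf (hp : ¬ 3 ∣ p) : 3 * kOf p = 4 * (p : ℤ) ^ 2 - 1 :=
  Int.mul_ediv_cancel' (three_dvd_four_mul_sq_sub_one hp)

/-- `k(p) ≥ 1` for `p ≥ 1`, `3 ∤ p`. -/
theorem one_le_kOf (hp : ¬ 3 ∣ p) (hp1 : 1 ≤ p) : 1 ≤ kOf p := by
  have h := three_mul_kOf hp
  have : (1 : ℤ) ≤ p := by exact_mod_cast hp1
  nlinarith

/-- `c₄ = 16 (A² + AB + B²)` with `(A, B) = (1, 3k)` (translation-invariant covariant). -/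
theorem freyFamily_c₄ (p : ℕ) :
    (freyFamily p).c₄ = 16 * (1 ^ 2 + 1 * (3 * kOf p) + (3 * kOf p) ^ 2) := by
  simp only [freyFamily, WeierstrassCurve.c₄, WeierstrassCurve.b₂, WeierstrassCurve.b₄]; ring

/-- `c₆ = −32 (B − A)(2A + B)(A + 2B)` with `(A, B) = (1, 3k)`. -/
theorem freyFamily_c₆ (p : ℕ) :
    (freyFamily p).c₆ = -32 * ((3 * kOf p - 1) * (3 * kOf p + 2) * (6 * kOf p + 1)) := by
  simp only [freyFamily, WeierstrassCurve.c₆, WeierstrassCurve.b₂, WeierstrassCurve.b₄,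
    WeierstrassCurve.b₆]; ring

/-- `Δ = 16 (AB(A+B))²` with `(A, B) = (1, 3k)`. -/
theorem freyFamily_Δ (p : ℕ) :
    (freyFamily p).Δ = 16 * (1 * (3 * kOf p) * (1 + 3 * kOf p)) ^ 2 := by
  simp only [freyFamily, WeierstrassCurve.Δ, WeierstrassCurve.b₂, WeierstrassCurve.b₄,
    WeierstrassCurve.b₆, WeierstrassCurve.b₈]; ring

/-- `c₄ = 16 (16p⁴ − 4p² + 1)` (`3 ∤ p`). -/
theorem freyFamily_c₄_eq (hp : ¬ 3 ∣ p) :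
    (freyFamily p).c₄ = 16 * (16 * (p : ℤ) ^ 4 - 4 * (p : ℤ) ^ 2 + 1) := by
  rw [freyFamily_c₄]
  have h := three_mul_kOf hp
  rw [h]; ring

/-- `Δ = 256 p⁴ (4p² − 1)²` (`3 ∤ p`). -/
theorem freyFamily_Δ_eq (hp : ¬ 3 ∣ p) :
    (freyFamily p).Δ = 256 * (p : ℤ) ^ 4 * (4 * (p : ℤ) ^ 2 - 1) ^ 2 := by
  rw [freyFamily_Δ, three_mul_kOf hp]; ring

end Family

end Summit.ABC.ABC.Theorems.SomeWindowSaving.Negative
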